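import Summits.Ventures.PercRepro.RankDistTightParallelCount
import Summits.Ventures.PercRepro.RankDistIrreducible

/-!
# PercRepro — the cumulative shadow inequality on the tight layer REDUCES TO SIMPLE MATROIDS (p9, gen 19)

On the tight layer `|E| = p + q` (`RankDistTight`): a LOOP empties the bottom family (`Uq_eq_empty_of_isLoop_tight`:
a bottom set is an independent `q`-set with a base as complement, and a loop is in neither), so the cumulative
shadow inequality holds trivially (`shadowCumulative_of_Uq_eq_empty`); a PARALLEL PAIR `{x, x'}` reduces the
inequality at `(p, q)` to the minor `M ／ x ＼ x'` at `(p − 1, q − 1)`, again on the tight layer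
(`RankDistTightParallelCount`; `card_gr_parallelMinor`, `eRank_parallelMinor_add_one` here); the level `q = 0` is
the theorem `shadowCumulative_zero` (`RankDistIrreducible`). Hence, by strong induction on `|E|`
(**`shadowCumulative_tight_of_simple`**): if `ShadowCumulative N p q` holds on every SIMPLE (loopless, no two
distinct elements parallel) matroid of the tight layer with `q + 2 ≤ p`, it holds on every matroid of the tight
layer with `q + 2 ≤ p`. Nothing here is a statement about any window of the crux.
-/

namespace PercRepro.RankDist

open Set Finset _root_.Matroid PercRepro.ThmH

variable {α : Type} [DecidableEq α] (M : Matroid α) [M.Finite]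

omit [DecidableEq α] [M.Finite] in
/-- Removing an element of `cl(S ∖ e)` from `S` keeps the rank. -/
lemma eRk_diff_singleton_of_mem_closure {e : α} {S : Set α} (heS : e ∈ S)
    (he : e ∈ M.closure (S \ {e})) : M.eRk (S \ {e}) = M.eRk S := by
  have h1 : insert e (S \ {e}) = S := by
    rw [Set.insert_sdiff_singleton, Set.insert_eq_of_mem heS]
  calc M.eRk (S \ {e}) = M.eRk (insert e (S \ {e})) := (eRk_insert_eq_of_mem_closure M he).symm
    _ = M.eRk S := by rw [h1]

/-- **A loop empties the bottom family of the tight layer**: with `|E| = p + q`, a bottom set of `(p, q)` has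
`q` elements and rank `q`, its complement `p` elements and rank `p`, and a loop lowers the count, not the rank. -/
theorem Uq_eq_empty_of_isLoop_tight {p q : ℕ} (hn : (gr M).card = p + q) {e : α} (he : M.IsLoop e) :
    PerFlat.Uq M p q = ∅ := by
  rw [Finset.eq_empty_iff_forall_notMem]
  intro B hB
  obtain ⟨hBq, hDp⟩ := card_eq_of_mem_Uq_tight M hn hB
  rw [PerFlat.mem_Uq] at hB
  obtain ⟨hBE, hBrk, hDrk⟩ := hB
  have heE : e ∈ gr M := by rw [← Finset.mem_coe, coe_gr]; exact he.mem_ground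
  by_cases heB : e ∈ B
  · have h1 : M.eRk ((B : Set α) \ {e}) = (q : ℕ∞) := by
      rw [eRk_diff_singleton_of_mem_closure M (Finset.mem_coe.2 heB) (he.mem_closure _), hBrk]
    have h2 := M.eRk_le_encard ((B : Set α) \ {e})
    rw [h1, ← Finset.coe_erase, Set.encard_coe_eq_coe_finsetCard, Finset.card_erase_of_mem heB, hBq] at h2
    have h3 : q ≤ q - 1 := by exact_mod_cast h2
    have h4 : 1 ≤ q := by
      have := Finset.card_pos.2 ⟨e, heB⟩
      omega
    omega
  · have heD : e ∈ gr M \ B := Finset.mem_sdiff.2 ⟨heE, heB⟩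
    have h1 : M.eRk (((gr M \ B : Finset α) : Set α) \ {e}) = (p : ℕ∞) := by
      rw [eRk_diff_singleton_of_mem_closure M (Finset.mem_coe.2 heD) (he.mem_closure _), hDrk]
    have h2 := M.eRk_le_encard (((gr M \ B : Finset α) : Set α) \ {e})
    rw [h1, ← Finset.coe_erase, Set.encard_coe_eq_coe_finsetCard, Finset.card_erase_of_mem heD, hDp] at h2
    have h3 : p ≤ p - 1 := by exact_mod_cast h2
    have h4 : 1 ≤ p := by
      have := Finset.card_pos.2 ⟨e, heD⟩
      omega
    omega

/-- Without bottom sets the shadow is empty at every level and the cumulative shadow inequality is `0 ≤ 0`. -/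
theorem shadowCumulative_of_Uq_eq_empty {p q : ℕ} (h : PerFlat.Uq M p q = ∅) : ShadowCumulative M p q := by
  intro u _ _
  have hempty : ∀ v, shadowLev M v (PerFlat.Uq M p q) = ∅ := by
    intro v
    rw [Finset.eq_empty_iff_forall_notMem]
    intro A hA
    obtain ⟨-, -, B, hB, -⟩ := (mem_shadowLev M).1 hA
    rw [h] at hB
    exact Finset.notMem_empty _ hB
  rw [hempty q, hempty u, Finset.card_empty, zero_mul, zero_mul]

section ParallelPair

variable {x x' : α}

/-- The minor `M ／ x ＼ x'` has two elements fewer. -/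
lemma card_gr_parallelMinor (hx : M.IsNonloop x) (hx' : M.IsNonloop x') (hne : x ≠ x') :
    (gr ((M.contract {x}).delete {x'})).card + 2 = (gr M).card := by
  have hxE : x ∈ gr M := by rw [← Finset.mem_coe, coe_gr]; exact hx.mem_ground
  have hx'E : x' ∈ (gr M).erase x := Finset.mem_erase.2 ⟨hne.symm, by
    rw [← Finset.mem_coe, coe_gr]; exact hx'.mem_ground⟩
  rw [gr_parallelMinor, Finset.card_erase_of_mem hx'E, Finset.card_erase_of_mem hxE]
  have := Finset.card_pos.2 ⟨x, hxE⟩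
  have h2 := Finset.card_erase_of_mem hxE
  have h3 := Finset.card_pos.2 ⟨x', hx'E⟩
  omega

omit [DecidableEq α] [M.Finite] in
/-- The minor `M ／ x ＼ x'` has rank one less than `M`. -/
lemma eRank_parallelMinor_add_one (hx : M.IsNonloop x) (hxx' : x' ∈ M.closure {x}) (hne : x ≠ x') :
    ((M.contract {x}).delete {x'}).eRank + 1 = M.eRank := by
  have hxE : x ∈ M.E := hx.mem_ground
  have hx'E : x' ∈ M.E := M.closure_subset_ground _ hxx'
  rw [← eRk_ground, ← eRk_ground, parallelMinor_ground,
    parallelMinor_eRk_add_one M hx (subset_refl _)]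
  have h1 : insert x (M.E \ {x, x'}) = M.E \ {x'} := by
    ext z
    simp only [Set.mem_insert_iff, Set.mem_sdiff, Set.mem_singleton_iff, not_or]
    constructor
    · rintro (rfl | ⟨hzE, -, hz⟩)
      · exact ⟨hxE, hne⟩
      · exact ⟨hzE, hz⟩
    · rintro ⟨hzE, hz⟩
      by_cases hzx : z = x
      · exact Or.inl hzx
      · exact Or.inr ⟨hzE, hzx, hz⟩
  rw [h1]
  exact eRk_diff_singleton_of_mem_closure M hx'E
    (M.closure_subset_closure (Set.singleton_subset_iff.2
      (⟨hxE, fun h => hne (Set.mem_singleton_iff.1 h)⟩ : x ∈ M.E \ {x'})) hxx')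

end ParallelPair

/-- **THE CUMULATIVE SHADOW INEQUALITY ON THE TIGHT LAYER REDUCES TO SIMPLE MATROIDS.** If
`ShadowCumulative N p q` holds for every loopless matroid `N` without parallel pairs with `|E| = p + q`,
`ρ(E) = p`, `q + 2 ≤ p`, then it holds for every finite matroid of the tight layer with `q + 2 ≤ p`
(strong induction on `|E|`: loops empty the bottom family, a parallel pair reduces to the minor, `q = 0` is
`shadowCumulative_zero`). -/
theorem shadowCumulative_tight_of_simple
    (H : ∀ (N : Matroid α) [N.Finite] (p q : ℕ), (gr N).card = p + q → N.eRank = (p : ℕ∞) → q + 2 ≤ p →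
      (∀ e ∈ N.E, N.IsNonloop e) → (∀ e ∈ N.E, ∀ f ∈ N.E, e ≠ f → f ∉ N.closure {e}) →
      ShadowCumulative N p q) :
    ∀ (n : ℕ) (N : Matroid α) [N.Finite] (p q : ℕ), (gr N).card = n → n = p + q →
      N.eRank = (p : ℕ∞) → q + 2 ≤ p → ShadowCumulative N p q := by
  intro n
  refine Nat.strong_induction_on n ?_
  intro n ih N _ p q hNn hn hr hqp
  by_cases hloop : ∀ e ∈ N.E, N.IsNonloop e
  · by_cases hsimp : ∀ e ∈ N.E, ∀ f ∈ N.E, e ≠ f → f ∉ N.closure {e}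
    · exact H N p q (hNn.trans hn) hr hqp hloop hsimp
    · push Not at hsimp
      obtain ⟨x, hxE, x', hx'E, hne, hxx'⟩ := hsimp
      have hx : N.IsNonloop x := hloop x hxE
      have hx' : N.IsNonloop x' := hloop x' hx'E
      by_cases hq : q = 0
      · subst hq; exact shadowCumulative_zero N p hr
      obtain ⟨q', rfl⟩ : ∃ q', q = q' + 1 := ⟨q - 1, by omega⟩
      obtain ⟨p', rfl⟩ : ∃ p', p = p' + 1 := ⟨p - 1, by omega⟩
      have hcard := card_gr_parallelMinor N hx hx' hne
      have hrank := eRank_parallelMinor_add_one N hx hxx' hne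
      rw [hr] at hrank
      have hrank' : ((N.contract {x}).delete {x'}).eRank = (p' : ℕ∞) := by
        have h : ((N.contract {x}).delete {x'}).eRank + 1 = (p' : ℕ∞) + 1 := by rw [hrank]; push_cast; rfl
        exact WithTop.add_right_cancel WithTop.one_ne_top h
      have ih' := ih (gr ((N.contract {x}).delete {x'})).card (by omega) ((N.contract {x}).delete {x'})
        p' q' rfl (by omega) hrank' (by omega)
      exact shadowCumulative_of_parallel N (p := p') (q := q') (by omega) hx hx' hxx' hne ih'
  · push Not at hloop
    obtain ⟨e, heE, he⟩ := hloop
    have hl : N.IsLoop e := by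
      by_contra h
      exact he ((not_isLoop_iff heE).1 h)
    exact shadowCumulative_of_Uq_eq_empty N (Uq_eq_empty_of_isLoop_tight N (hNn.trans hn) hl)

end PercRepro.RankDist
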